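import Literature.RingTheory.FormalGroups.FormalGroupHomFrobenius              -- ★ p844727 F0P6-p06 (g0): `FormalGroupHom.exists_eq_expand_pow_coeff_one_ne_zero` (Fröhlich I §3 Thm. 2, ring level)
import Literature.RingTheory.FormalGroups.FormalOModuleHeightOfFrobeniusForm   -- ★ p844746 A-p17 (g23): `FormalOModuleLaw.exists_isOfHeight_of_act_eq_subst_X_pow_prime_pow`, `exists_prime_charP_of_algebraMap_uniformizer_eq_zero`
import HarnessLib

/-!
# Crux `HLiu418` — P6 sub-line **F0-P6d FormalModuleKernels**, stub (HL-A) `HeightDichotomy` PAID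

Cell `hodgecm-mathlib`, P6 «MOD programme» (LEAD F0P6-plan (g0), sub-desk F0P6d-plan (g0)), line `Cruxes/HLiu418/Lines/F0_P6d_FormalModuleKernels.lean`
(tree v1 sha16 `3afe0ec0cb9e5ccd`, ED. 2 cand folds HL-B∕HL-C), registered stub (HL-A) `stub_HLA : HeightDichotomy` («height dichotomy ∕ normal form over a field»,
:≈112–120 of the line).  This file proves THE TEXT OF `HeightDichotomy.{u, v}` VERBATIM (same binders, same universe order) as the theorem `heightDichotomy`, so that
the desk folds `stub_HLA := F0P6dStubHLA.heightDichotomy` BY NAME at the next edition.  The proof is the composition of two ★ Literature organs: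
F0P6-p06 (g0)'s ★ `FormalGroupHom.exists_eq_expand_pow_coeff_one_ne_zero` (a nonzero homomorphism over a ring of characteristic `p` is `g(X^{p^n})` with `g′(0) ≠ 0`,
[Frohlich1968] Ch. I §3 Thm. 2) and A-p17 (g23)'s ★ `FormalOModuleLaw.exists_isOfHeight_of_act_eq_subst_X_pow_prime_pow` (`𝒪`-linearity: `p^n = q^h`, `h ≥ 1`),
with the prime `p := char k` supplied by ★ `exists_prime_charP_of_algebraMap_uniformizer_eq_zero`.  HC_CM is proved only modulo the printed citations until rung 0
closes; nothing here is about HC — it discharges one registered stub of the P6d kernels line.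
-/

-- The cell's namespace `Summit.HodgeConjecture.HodgeConjecture.…` repeats `HodgeConjecture` (summit = sub-problem), which `linter.dupNamespace` flags; the lakefile
-- turns the linter off tree-wide (weak option), restated here so stand-alone elaboration is warning-free.
set_option linter.dupNamespace false

namespace Summit.HodgeConjecture.HodgeConjecture.Cruxes.HLiu418.F0P6dStubHLA

universe u v

open Literature.RingTheory.FormalGroups (FormalGroupHom FormalOModuleLaw)

-- The REGISTERED text carries both `[IsDomain 𝒪]` and `[IsDiscreteValuationRing 𝒪]` (each implies `[Nontrivial 𝒪]`); the statement must stay verbatim, so the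
-- overlapping-instances linter is silenced for this one declaration (tree precedent: `Literature/Algebra/EuclideanLattices/LatticeGeometry.lean` et al.).
set_option linter.overlappingInstances false in
/-- **Stub (HL-A) «height dichotomy ∕ normal form over a field» — the text of `F0P6dFormalModuleKernels.HeightDichotomy` verbatim.**  `𝒪` a DVR with finite residue
field (cardinality `q`), `ϖ` a uniformiser, `k` a field and `𝒪`-algebra with `ϖ ↦ 0`, `M` a formal `𝒪`-module law over `k`: either `[ϖ]_F = 0`, or `M` has an
`𝒪`-height `h ≥ 1` (`[ϖ]_F(T) = u(T^{q^h})`, `u′(0) ∈ kˣ`).  Proof: if `[ϖ]_F ≠ 0`, ★ `exists_eq_expand_pow_coeff_one_ne_zero` (char `k = p`, ★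
`exists_prime_charP_of_algebraMap_uniformizer_eq_zero`) writes `[ϖ]_F = g(X^{p^n})`, `g′(0) ≠ 0`; ★ `exists_isOfHeight_of_act_eq_subst_X_pow_prime_pow` upgrades `p^n` to `q^h`,
`h ≥ 1`. [cite: Frohlich1968, Ch. I §3 Thm. 2] [cite: HarrisTaylorAMS2001, §II.1 p. 59] -/
theorem heightDichotomy :
    ∀ (𝒪 : Type u) [CommRing 𝒪] [IsDomain 𝒪] [IsDiscreteValuationRing 𝒪] [Finite (IsLocalRing.ResidueField 𝒪)] (ϖ : 𝒪),
    Irreducible ϖ → ∀ (k : Type v) [Field k] [Algebra 𝒪 k], algebraMap 𝒪 k ϖ = 0 →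
      ∀ M : FormalOModuleLaw 𝒪 k,
        (M.act ϖ).toPowerSeries = 0 ∨ ∃ h, 0 < h ∧ M.IsOfHeight ϖ (Nat.card (IsLocalRing.ResidueField 𝒪)) h := by
  intro 𝒪 _ _ _ _ ϖ hϖ k _ _ hϖk M
  by_cases h0 : (M.act ϖ).toPowerSeries = 0
  · exact Or.inl h0
  · right
    obtain ⟨p, hp, hchar⟩ := Literature.RingTheory.FormalGroups.exists_prime_charP_of_algebraMap_uniformizer_eq_zero hϖ hϖk
    haveI : Fact p.Prime := ⟨hp⟩
    obtain ⟨n, g, hg, h1⟩ := (M.act ϖ).exists_eq_expand_pow_coeff_one_ne_zero p h0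
    have hr : (M.act ϖ).toPowerSeries = PowerSeries.subst ((PowerSeries.X : PowerSeries k) ^ (p ^ n)) g.toPowerSeries := by
      rw [hg, PowerSeries.expand_apply]
    exact M.exists_isOfHeight_of_act_eq_subst_X_pow_prime_pow ϖ hϖ hϖk p g.constantCoeff_eq_zero h1 hr

end Summit.HodgeConjecture.HodgeConjecture.Cruxes.HLiu418.F0P6dStubHLA
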